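import Summits.KontsevichZagierPeriods.Zeta5Search.Barrier.ConeGammaEnvelopeC1
import Summits.KontsevichZagierPeriods.Zeta5Search.Barrier.ConeGammaEnvelopeConcave

/-!
# ζ(5) search — BARRIER: THE ENVELOPE BOUND WITHOUT CALCULUS — `C₁` to first order on a box (statements)

HONEST FRAMING (cell `pub-zeta5`): systematic search; no irrationality claim unless kernel-certified. Theorems only (plus
the two integer distance budgets `distX/distY`). MODEL objects under Brown–Zudilin's (28)+(30) ((28) observed, not proved):
`C₁ = C1` of `ConeGammaRates`, cert-2 g38's `CritFar.critFarCheck`, cert-2 g39's `Envelope.envBoxCheck`. Every statement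
is an enclosure of `C₁` on a direction box RELATIVE TO ITS VALUE AT THE BOX CENTRE; nothing about any γ, the cone's
supremum (C2 OPEN), S-E (CONJECTURED), (TD_A) or `ζ(5)`; no number of record moves; records in print UNMOVED. Theory seat
cert-2 g39 (item «THE ENVELOPE BOUND FOR C₁ WITHOUT CALCULUS», part 4b).

* `distX/distY` — the `Q`-distance budget `Σ|ax| + 2·wx` between a box root and the centre root of one moving box
  (`dist_of_loc`; the centre root sits within `wx` of `cx` because every box noise vanishes at the centre);
* **`C1_first_order_hull`** — `critFarCheck` + the envelope summary ⟹ for every box direction `t` with `Regular (aOfS t)`,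
  `Regular (aOfS c)`: `∃ v ∈ hull, |C₁(aOfS t) − C₁(aOfS c) − Σ_i (t_i − c_i)·v_i| ≤ e/(SC·Q)` — the Taylor model;
* **`C1_first_order`** — with `envBoxCheck … p q`: `|C₁(aOfS t) − C₁(aOfS c)| ≤ p/q`;
* `C1_box_of_checks` — the transfer to every direction `a` of the closed box: `|C₁(a)/s₀(a) − C₁(aOfS c)| ≤ p/q`;
* **`C1_upper_hull`**, **`C1_upper_box`**, `C1_le_centre_add` — the ONE-SIDED forms with the concavity certificate
  `concCheck` (no tangent-difference budget): `C₁(aOfS t) − C₁(aOfS c) ≤ Σ (t_i − c_i)·v_i`, `≤ p/q`,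
  `C₁(a) ≤ s₀(a)·(C₁(aOfS c) + p/q)` — the envelope bound proper.
-/

noncomputable section

open Set
open Literature.Analysis.ValidatedNumerics.NumericsMP

namespace Summit.KontsevichZagierPeriods.Zeta5Search.Barrier.ConeGamma

namespace Envelope

open Literature.Analysis.ValidatedNumerics (AForm)
open Literature.Analysis.ValidatedNumerics.AForm
open LemmaFBox (SC SC_pos box centre centre_mem)
open CritBox CritFar

/-! ### `C₁` to first order -/

/-- The `Q`-distance budget between a box root and the centre root of the same moving box: `Σ|ax| + 2·wx`. -/
def distX (rd : RootData) : ℕ := absSum rd.ax + 2 * rd.wx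

/-- The `Q`-distance budget in the second coordinate: `Σ|av| + 2·wv`. -/
def distY (rd : RootData) : ℕ := absSum rd.av + 2 * rd.wv

/-- Distance of a box root to the centre root from the two location bounds. -/
theorem dist_of_loc {Q : ℝ} (hQ : 0 ≤ Q) {c : ℤ} {S w : ℕ} {X Xc : ℝ} (h1 : |X * Q - c| ≤ ((S + w : ℕ) : ℝ))
    (h2 : |Xc * Q - c| ≤ (w : ℝ)) : |X - Xc| * Q ≤ ((S + 2 * w : ℕ) : ℝ) := by
  have e : (X - Xc) * Q = (X * Q - c) - (Xc * Q - c) := by ring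
  calc |X - Xc| * Q = |(X - Xc) * Q| := by rw [abs_mul, abs_of_nonneg hQ]
    _ = |(X * Q - c) - (Xc * Q - c)| := by rw [e]
    _ ≤ |X * Q - c| + |Xc * Q - c| := abs_sub _ _
    _ ≤ ((S + w : ℕ) : ℝ) + w := add_le_add h1 h2
    _ = ((S + 2 * w : ℕ) : ℝ) := by push_cast; ring

/-- **`Regular` at the box centre from `Regular` on the box**: if every direction of the closed box whose normalised
parameters lie in the box is regular (cert-2 g37/g38's `regular_box_*` / `regular_farBox_*`), so is `aOfS c`. -/
theorem regular_centre {D : ℕ} {lo hi : List ℕ} (hbox : LemmaFWinBox.boxOK8 D lo hi = true)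
    (hreg : ∀ {a : Dir}, BZBox a → (∀ j : Fin 7, ((lo.getD j.succ 0 : ℕ) : ℝ) ≤ sParam a j.succ / sParam a 0 * D ∧
      sParam a j.succ / sParam a 0 * D ≤ ((hi.getD j.succ 0 : ℕ) : ℝ)) → Regular a) :
    Regular (aOfS (centre D lo hi)) := by
  obtain ⟨hD, h0, h0', hle⟩ := LemmaFWinBox.boxOK8_spec hbox
  have hD' : (0 : ℝ) < D := by exact_mod_cast hD
  have hcmem : centre D lo hi ∈ LemmaFBox.box D lo hi := centre_mem hD (fun i => (hle i).1)
  have hc0 : centre D lo hi 0 = 1 := by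
    have e0 : ((lo.getD 0 0 : ℕ) : ℝ) = D := by exact_mod_cast h0
    have e0' : ((hi.getD 0 0 : ℕ) : ℝ) = D := by exact_mod_cast h0'
    show (((lo.getD 0 0 : ℕ) : ℝ) + ((hi.getD 0 0 : ℕ) : ℝ)) / (2 * D) = 1
    rw [e0, e0']; field_simp; ring
  have hs : sParam (aOfS (centre D lo hi)) = centre D lo hi := sParam_aOfS _
  have hcj : ∀ j : Fin 7, 0 ≤ centre D lo hi j.succ ∧ centre D lo hi j.succ ≤ 1 := by
    intro j
    have a := (hcmem j.succ).1; have b := (hcmem j.succ).2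
    have hhi : ((hi.getD j.succ 0 : ℕ) : ℝ) ≤ D := by exact_mod_cast (hle j.succ).2
    have hlo : (0 : ℝ) ≤ ((lo.getD j.succ 0 : ℕ) : ℝ) := Nat.cast_nonneg _
    constructor
    · nlinarith
    · nlinarith
  apply hreg
  · refine ⟨by rw [hs, hc0]; exact one_pos, fun j => ?_⟩
    rw [hs, hc0]; exact hcj j
  · intro j
    rw [hs, hc0, div_one]
    exact hcmem j.succ

/-- **`C₁` TO FIRST ORDER ON A BOX (Taylor-model form).** `critFarCheck` (g38) + the envelope summary on the same box with
the tube of `r2` and the distances `distX r2`, `distY r2`: for every box direction `t` with `Regular (aOfS t)` and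
`Regular (aOfS c)`, `c` the box centre, `∃ v ∈ hull, |C₁(aOfS t) − C₁(aOfS c) − Σ_i (t_i − c_i)·v_i| ≤ e/(SC·Q)`. -/
theorem C1_first_order_hull {D T : ℕ} {lo hi : List ℕ} {r0 r2 : RootData} {fd : FarData}
    {c0lo c0hi c1hi : ℤ} {den : ℕ} (hc : critFarCheck D T lo hi r0 r2 fd c0lo c0hi c1hi den = true)
    (hlenx : r2.ax.length = 7) (hok : envOK D T lo hi (tubeOfRoot r2) = true)
    {g : List MI} {e : ℤ} (hs : envSummary D T lo hi (tubeOfRoot r2) (distX r2) (distY r2) = some (g, e))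
    {t : Fin 8 → ℝ} (h : t ∈ LemmaFBox.box D lo hi) (hreg : Regular (aOfS t))
    (hregc : Regular (aOfS (centre D lo hi))) :
    ∃ v : Fin 8 → ℝ, (∀ i : Fin 8, MI.mem SC (v i) (LemmaFWinBox.getI g i)) ∧
      |C1 (aOfS t) - C1 (aOfS (centre D lo hi)) - ∑ i : Fin 8, (t i - centre D lo hi i) * v i|
        ≤ (e : ℝ) / (SC * (2 * D * T)) := by
  obtain ⟨hD, _, _, _, hle, _⟩ := envOK_spec hok
  have hcmem : centre D lo hi ∈ LemmaFBox.box D lo hi := centre_mem hD (fun i => (hle i).1)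
  have ht0 := (openBox_of_envOK hok h).1
  have hc0 := (openBox_of_envOK hok hcmem).1
  obtain ⟨X, Y, hk, hXY, e1, lX, lY, _⟩ := exists_C1_point_of_critFarCheck hc hlenx h ht0 hreg
  obtain ⟨Xc, Yc, hkc, hXYc, e2, _, _, lc⟩ := exists_C1_point_of_critFarCheck hc hlenx hcmem hc0 hregc
  obtain ⟨lXc, lYc⟩ := lc rfl
  have eQ : ((2 * D * T : ℕ) : ℝ) = 2 * (D : ℝ) * T := by push_cast; ring
  have hdX : |X - Xc| * (2 * (D : ℝ) * T) ≤ ((distX r2 : ℕ) : ℝ) := by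
    rw [← eQ]; exact dist_of_loc (by positivity) lX lXc
  have hdY : |Y - Yc| * (2 * (D : ℝ) * T) ≤ ((distY r2 : ℕ) : ℝ) := by
    rw [← eQ]; exact dist_of_loc (by positivity) lY lYc
  obtain ⟨v, hv, hb⟩ := critical_value_first_order hok hs h hXY hk hXYc hkc hdX hdY
  exact ⟨v, hv, by rw [e1, e2]; exact hb⟩

/-- **`C₁` TO FIRST ORDER ON A BOX (numeric form).** `critFarCheck` (g38) and `envBoxCheck … (distX r2) (distY r2) p q` on
the same box with the tube of `r2`: for every box direction `t` with `Regular (aOfS t)` and `Regular (aOfS c)`: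
`|C₁(aOfS t) − C₁(aOfS c)| ≤ p/q`. -/
theorem C1_first_order {D T : ℕ} {lo hi : List ℕ} {r0 r2 : RootData} {fd : FarData}
    {c0lo c0hi c1hi : ℤ} {den : ℕ} (hc : critFarCheck D T lo hi r0 r2 fd c0lo c0hi c1hi den = true)
    (hlenx : r2.ax.length = 7) {p : ℤ} {q : ℕ}
    (hchk : envBoxCheck D T lo hi (tubeOfRoot r2) (distX r2) (distY r2) p q = true)
    {t : Fin 8 → ℝ} (h : t ∈ LemmaFBox.box D lo hi) (hreg : Regular (aOfS t))
    (hregc : Regular (aOfS (centre D lo hi))) :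
    |C1 (aOfS t) - C1 (aOfS (centre D lo hi))| ≤ (p : ℝ) / q := by
  have hok : envOK D T lo hi (tubeOfRoot r2) = true := by
    unfold envBoxCheck at hchk; simp only [Bool.and_eq_true] at hchk; exact hchk.1.1
  obtain ⟨hD, _, _, _, hle, _⟩ := envOK_spec hok
  have hcmem : centre D lo hi ∈ LemmaFBox.box D lo hi := centre_mem hD (fun i => (hle i).1)
  have ht0 := (openBox_of_envOK hok h).1
  have hc0 := (openBox_of_envOK hok hcmem).1
  obtain ⟨X, Y, hk, hXY, e1, lX, lY, _⟩ := exists_C1_point_of_critFarCheck hc hlenx h ht0 hreg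
  obtain ⟨Xc, Yc, hkc, hXYc, e2, _, _, lc⟩ := exists_C1_point_of_critFarCheck hc hlenx hcmem hc0 hregc
  obtain ⟨lXc, lYc⟩ := lc rfl
  have eQ : ((2 * D * T : ℕ) : ℝ) = 2 * (D : ℝ) * T := by push_cast; ring
  have hdX : |X - Xc| * (2 * (D : ℝ) * T) ≤ ((distX r2 : ℕ) : ℝ) := by
    rw [← eQ]; exact dist_of_loc (by positivity) lX lXc
  have hdY : |Y - Yc| * (2 * (D : ℝ) * T) ≤ ((distY r2 : ℕ) : ℝ) := by
    rw [← eQ]; exact dist_of_loc (by positivity) lY lYc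
  rw [e1, e2]
  exact critical_value_box hchk h hXY hk hXYc hkc hdX hdY

/-- **`C₁` TO FIRST ORDER, ONE-SIDED (the envelope bound proper).** `critFarCheck` (g38), `envOK`, the concavity
certificate `concCheck` and the envelope summary: for every box direction `t` with `Regular (aOfS t)`, `Regular (aOfS c)`:
`∃ v ∈ hull, C₁(aOfS t) − C₁(aOfS c) ≤ Σ_i (t_i − c_i)·v_i` — NO tangent-difference budget (the centre's top critical point
maximises `V(c, ·)` on the tube). -/
theorem C1_upper_hull {D T : ℕ} {lo hi : List ℕ} {r0 r2 : RootData} {fd : FarData}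
    {c0lo c0hi c1hi : ℤ} {den : ℕ} (hc : critFarCheck D T lo hi r0 r2 fd c0lo c0hi c1hi den = true)
    (hlenx : r2.ax.length = 7) (hok : envOK D T lo hi (tubeOfRoot r2) = true)
    (hcc : concCheck D T lo hi (tubeOfRoot r2) = true) {dX dY : ℕ}
    {g : List MI} {e : ℤ} (hs : envSummary D T lo hi (tubeOfRoot r2) dX dY = some (g, e))
    {t : Fin 8 → ℝ} (h : t ∈ LemmaFBox.box D lo hi) (hreg : Regular (aOfS t))
    (hregc : Regular (aOfS (centre D lo hi))) :
    ∃ v : Fin 8 → ℝ, (∀ i : Fin 8, MI.mem SC (v i) (LemmaFWinBox.getI g i)) ∧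
      C1 (aOfS t) - C1 (aOfS (centre D lo hi)) ≤ ∑ i : Fin 8, (t i - centre D lo hi i) * v i := by
  obtain ⟨hD, _, _, _, hle, _⟩ := envOK_spec hok
  have hcmem : centre D lo hi ∈ LemmaFBox.box D lo hi := centre_mem hD (fun i => (hle i).1)
  have ht0 := (openBox_of_envOK hok h).1
  have hc0 := (openBox_of_envOK hok hcmem).1
  obtain ⟨X, Y, hk, hXY, e1, _⟩ := exists_C1_point_of_critFarCheck hc hlenx h ht0 hreg
  obtain ⟨Xc, Yc, hkc, hXYc, e2, _⟩ := exists_C1_point_of_critFarCheck hc hlenx hcmem hc0 hregc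
  obtain ⟨v, hv, hb⟩ := critical_value_first_order_upper hok hcc hs h hXY hk hXYc hkc
  exact ⟨v, hv, by rw [e1, e2]; exact hb⟩

/-- **`C₁` ON A BOX FROM ITS CENTRE VALUE, ONE-SIDED (numeric form).** `critFarCheck` (g38) and `envUpperCheck … p q`:
for every box direction `t` with `Regular (aOfS t)` and `Regular (aOfS c)`: `C₁(aOfS t) ≤ C₁(aOfS c) + p/q`. -/
theorem C1_upper_box {D T : ℕ} {lo hi : List ℕ} {r0 r2 : RootData} {fd : FarData}
    {c0lo c0hi c1hi : ℤ} {den : ℕ} (hc : critFarCheck D T lo hi r0 r2 fd c0lo c0hi c1hi den = true)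
    (hlenx : r2.ax.length = 7) {p : ℤ} {q : ℕ} (hchk : envUpperCheck D T lo hi (tubeOfRoot r2) p q = true)
    {t : Fin 8 → ℝ} (h : t ∈ LemmaFBox.box D lo hi) (hreg : Regular (aOfS t))
    (hregc : Regular (aOfS (centre D lo hi))) :
    C1 (aOfS t) ≤ C1 (aOfS (centre D lo hi)) + (p : ℝ) / q := by
  have hok : envOK D T lo hi (tubeOfRoot r2) = true := by
    unfold envUpperCheck at hchk; simp only [Bool.and_eq_true] at hchk; exact hchk.1.1.1
  obtain ⟨hD, _, _, _, hle, _⟩ := envOK_spec hok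
  have hcmem : centre D lo hi ∈ LemmaFBox.box D lo hi := centre_mem hD (fun i => (hle i).1)
  have ht0 := (openBox_of_envOK hok h).1
  have hc0 := (openBox_of_envOK hok hcmem).1
  obtain ⟨X, Y, hk, hXY, e1, _⟩ := exists_C1_point_of_critFarCheck hc hlenx h ht0 hreg
  obtain ⟨Xc, Yc, hkc, hXYc, e2, _⟩ := exists_C1_point_of_critFarCheck hc hlenx hcmem hc0 hregc
  have := critical_value_upper_box hchk h hXY hk hXYc hkc
  rw [e1, e2]; linarith

/-- **Transfer (one-sided)**: for every REGULAR direction `a` of the closed box whose normalised parameters lie in the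
box, `C₁(a) ≤ s₀(a)·(C₁(aOfS c) + p/q)`. -/
theorem C1_le_centre_add {D T : ℕ} {lo hi : List ℕ} {r0 r2 : RootData} {fd : FarData}
    {c0lo c0hi c1hi : ℤ} {den : ℕ} (hc : critFarCheck D T lo hi r0 r2 fd c0lo c0hi c1hi den = true)
    (hlenx : r2.ax.length = 7) {p : ℤ} {q : ℕ} (hchk : envUpperCheck D T lo hi (tubeOfRoot r2) p q = true)
    (hregc : Regular (aOfS (centre D lo hi))) {a : Dir} (ha : BZBox a)
    (hbox : ∀ j : Fin 7, ((lo.getD j.succ 0 : ℕ) : ℝ) ≤ sParam a j.succ / sParam a 0 * D ∧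
      sParam a j.succ / sParam a 0 * D ≤ ((hi.getD j.succ 0 : ℕ) : ℝ)) (hreg : Regular a) :
    C1 a ≤ sParam a 0 * (C1 (aOfS (centre D lo hi)) + (p : ℝ) / q) := by
  obtain ⟨ht, _⟩ := normalise_mem_box (boxOKc_of_critFarCheck hc) ha hbox
  have hs0 : 0 < sParam a 0 := ha.1
  have hn := LemmaFBox.aOfS_normalise ha
  have eR : Regular a ↔ Regular (aOfS fun i => sParam a i / sParam a 0) := by
    conv_lhs => rw [hn]
    exact regular_smul hs0 _
  have e1 : C1 a = sParam a 0 * C1 (aOfS fun i => sParam a i / sParam a 0) := by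
    conv_lhs => rw [hn]
    exact C1_smul hs0 _
  have := C1_upper_box hc hlenx hchk (t := fun i => sParam a i / sParam a 0) ht (eR.1 hreg) hregc
  rw [e1]
  exact mul_le_mul_of_nonneg_left this hs0.le

/-- **Transfer to every direction of the closed box**: for `a` with `BZBox a` whose normalised parameters
`t = s(a)/s₀(a)` lie in the box, `|C₁(a)/s₀(a) − C₁(aOfS c)| ≤ p/q` (homogeneity `C1_smul`). -/
theorem C1_box_of_checks {D T : ℕ} {lo hi : List ℕ} {r0 r2 : RootData} {fd : FarData}
    {c0lo c0hi c1hi : ℤ} {den : ℕ} (hc : critFarCheck D T lo hi r0 r2 fd c0lo c0hi c1hi den = true)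
    (hlenx : r2.ax.length = 7) {p : ℤ} {q : ℕ}
    (hchk : envBoxCheck D T lo hi (tubeOfRoot r2) (distX r2) (distY r2) p q = true)
    (hregc : Regular (aOfS (centre D lo hi))) {a : Dir} (ha : BZBox a)
    (hbox : ∀ j : Fin 7, ((lo.getD j.succ 0 : ℕ) : ℝ) ≤ sParam a j.succ / sParam a 0 * D ∧
      sParam a j.succ / sParam a 0 * D ≤ ((hi.getD j.succ 0 : ℕ) : ℝ)) (hreg : Regular a) :
    |C1 a / sParam a 0 - C1 (aOfS (centre D lo hi))| ≤ (p : ℝ) / q := by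
  obtain ⟨ht, _⟩ := normalise_mem_box (boxOKc_of_critFarCheck hc) ha hbox
  have hs0 : 0 < sParam a 0 := ha.1
  have hn := LemmaFBox.aOfS_normalise ha
  have eR : Regular a ↔ Regular (aOfS fun i => sParam a i / sParam a 0) := by
    conv_lhs => rw [hn]
    exact regular_smul hs0 _
  have e1 : C1 a = sParam a 0 * C1 (aOfS fun i => sParam a i / sParam a 0) := by
    conv_lhs => rw [hn]
    exact C1_smul hs0 _
  have := C1_first_order hc hlenx hchk (t := fun i => sParam a i / sParam a 0) ht (eR.1 hreg) hregc
  rw [e1, mul_div_cancel_left₀ _ hs0.ne']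
  exact this

end Envelope

end Summit.KontsevichZagierPeriods.Zeta5Search.Barrier.ConeGamma

end
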